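import Literature.Computability.MetaComplexity.BoundedArithSForm
import Literature.Computability.MetaComplexity.BoundedArithS2Blocks
import HarnessLib

/-!
# Uniformly `Σᵇ₁`-defined functions of `S₂¹` (`GDef`): graphs that are functional in every model

Topic `Literature/Computability/MetaComplexity`.  A function `f` is `Σᵇ₁`-*definable in* `S₂¹`
when one `Σᵇ₁` formula `φ(x̄, y)` defines its graph and `S₂¹` proves `∀x̄ ∃!y φ(x̄, y)`
(Buss 1986, §2.2, Definition; `IsSigmabDefinable` in `BoundedArithTheories.lean` for unary `f`).
With provability read semantically (Mathlib's `⊨ᵇ`), this means: `φ` is total and functional in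
*every* model of `S₂¹`.  This file packages such uniform definitions:

* `GDef n` — a graph `φ(x̄, y)` written as a named-variable bounded formula `SForm (n + 1)`
  (`BoundedArithSForm.lean`) together with a bounding term `t(x̄)`;
* `GDef.Rel`, `GDef.fn` — the relation it defines in a structure and the function selecting the
  witness; `GDef.IsFnIn M` — "`φ` is total, functional and bounded by `t` in `M`";
  **`GDef.Good`** — `φ` is syntactically `Σᵇ₁` and `IsFnIn M` holds in every
  `M ⊨ BASIC + Σᵇ₁-PIND` (i.e. in every model of `S₂¹`): this is "`S₂¹` `Σᵇ₁`-defines the function",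
  semantically; in such a model `fn` is then a `Σᵇ₁`-definable function with parameters
  (`GDef.Good.isSigmabFn`), so that the induction principles apply to predicates mentioning it;
* closure of `Good` under the constructions of Buss 1986, §2.2–2.3 (Thm. 2.2, Thm. 2.3: functions
  introduced by terms, by composition/substitution and by definition by cases): `GDef.ofTerm`,
  `GDef.substArgs` (substituting terms for the arguments), **`GDef.substLast`** (substituting a
  `Good` function for the last argument: `∃z ≤ t_G(x̄) (G(x̄, z) ∧ F(x̄, z, y))`, bound by
  monotonicity of terms), `GDef.num` (numerals);
* the primitives of the bootstrapping as `Good` `GDef`s with their values identified: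
  `GDef.pwG` (`2^{min(k,|S|)}`), `GDef.mspG`, `GDef.lspG` (`⌊a/2ᵏ⌋`, `a mod 2ᵏ`;
  `BoundedArithS2Div.lean`), `GDef.blkG` (`BoundedArithS2Blocks.lean`);
* terms applied to definitions (`GDef.map₁G`, `GDef.map₂G`, `GDef.addG`, `GDef.mulG`, `GDef.sumG`)
  and **definition by cases on the value of a key** (`GDef.select`, `GDef.good_select`,
  `GDef.fn_select_of_mem` / `fn_select_of_not_mem`; Buss 1986, §2.3; Krajíček 1995, §5.3).

## References

* S. R. Buss, *Bounded Arithmetic*, Bibliopolis 1986, §2.2 (Definition of `Σᵇ₁`-definable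
  function, Thm. 2.2), §2.3, §§2.4–2.5.
* J. Krajíček, *Bounded Arithmetic, Propositional Logic and Complexity Theory*, CUP 1995, §5.2.

## Design choices

* `Good` quantifies over all structures `M : Type` carrying `BASIC + Σᵇ₁-PIND` inside a `Prop`
  (impredicativity), matching the universe of Mathlib's `⊨ᵇ` for this language.
* `fn` is total by a junk default (`mZero M`) and is meaningful under `IsFnIn M`.
* The value lemmas (`fn_ofTerm`, `fn_substLast`, `fn_pwG`, …) are stated in a model of
  `BASIC + Σᵇ₁-PIND` (instance arguments), where `IsFnIn` is available from `Good`.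
-/

namespace Literature.Computability.MetaComplexity

open FirstOrder FirstOrder.Language

/-- **A uniform `Σᵇ₁` definition of an `n`-ary function**: a graph `φ(x̄, y)` (named variables
`Fin n` for `x̄`, `Fin.last n` for `y`) and a bounding term `t(x̄)` (Buss 1986, §2.2, Definition of
a `Σᵇ₁`-defined function: `S₂¹ ⊢ ∀x̄ ∃!y ≤ t φ`). [cite: Buss1986, §2.2] -/
structure GDef (n : ℕ) where
  /-- the defining formula `φ(x̄, y)`, `y` the last variable -/
  graph : SForm (n + 1)
  /-- the bounding term `t(x̄)` -/
  bound : Language.boundedArith.Term (Fin n)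

namespace GDef

variable {n m : ℕ}

/-! ## Semantics in a structure -/

section Semantics

variable {M : Type} [Language.boundedArith.Structure M]

/-- The relation `φ(x̄, y)` defined by `G` in a structure. [cite: Buss1986, §2.2] -/
def Rel (G : GDef n) (x : Fin n → M) (y : M) : Prop := G.graph.Realize (Fin.snoc x y)

open scoped Classical in
/-- The function selected by `G` in a structure: some `y` with `φ(x̄, y)` (and the junk value `0`
if there is none; meaningful under `IsFnIn`). [cite: Buss1986, §2.2] -/
noncomputable def fn (G : GDef n) (x : Fin n → M) : M :=
  if h : ∃ y, G.Rel x y then Classical.choose h else mZero M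

/-- **`G` defines a function in `M`**: `φ` is total and functional in `M` and its values obey the
bounding term (Buss 1986, §2.2: `∀x̄ ∃!y ≤ t(x̄) φ(x̄, y)` holds in `M`). [cite: Buss1986, §2.2] -/
structure IsFnIn (G : GDef n) (M : Type) [Language.boundedArith.Structure M] : Prop where
  /-- totality -/
  total : ∀ x : Fin n → M, ∃ y, G.Rel x y
  /-- functionality -/
  unique : ∀ (x : Fin n → M) (y y' : M), G.Rel x y → G.Rel x y' → y = y'
  /-- the bounding term bounds the values -/
  le_bound : ∀ (x : Fin n → M) (y : M), G.Rel x y → MLe y (G.bound.realize x)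

variable {G : GDef n}

/-- Under `IsFnIn`, `fn` is a witness. [folklore] -/
theorem IsFnIn.rel_fn (h : G.IsFnIn M) (x : Fin n → M) : G.Rel x (G.fn x) := by
  unfold fn
  rw [dif_pos (h.total x)]
  exact Classical.choose_spec (h.total x)

/-- Under `IsFnIn`, `φ(x̄, y) ↔ y = fn x̄`. [folklore] -/
theorem IsFnIn.rel_iff (h : G.IsFnIn M) {x : Fin n → M} {y : M} : G.Rel x y ↔ y = G.fn x :=
  ⟨fun hy => h.unique x _ _ hy (h.rel_fn x), fun e => e ▸ h.rel_fn x⟩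

/-- Under `IsFnIn`, `fn x̄ ≤ t(x̄)`. [folklore] -/
theorem IsFnIn.fn_le (h : G.IsFnIn M) (x : Fin n → M) : MLe (G.fn x) (G.bound.realize x) :=
  h.le_bound x _ (h.rel_fn x)

/-- Under `IsFnIn`, a witness is the value. [folklore] -/
theorem IsFnIn.fn_eq_of_rel (h : G.IsFnIn M) {x : Fin n → M} {y : M} (hy : G.Rel x y) :
    G.fn x = y :=
  (h.rel_iff.1 hy).symm

end Semantics

/-- **`G` is a good uniform `Σᵇ₁` definition**: its graph is syntactically `Σᵇ₁` and it defines a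
(bounded) function in every structure satisfying `BASIC + Σᵇ₁-PIND`, i.e. in every model of
`S₂¹` — "`S₂¹` `Σᵇ₁`-defines the function", semantically (Buss 1986, §2.2, Definition).
[cite: Buss1986, §2.2] -/
structure Good (G : GDef n) : Prop where
  /-- the graph is `Σᵇ₁` -/
  sig : G.graph.IsSig
  /-- total, functional and bounded in every model of `BASIC + Σᵇ₁-PIND` -/
  isFn : ∀ (M : Type) [Language.boundedArith.Structure M] [M ⊨ BASIC]
    [M ⊨ PINDScheme (sigmabFormulas 1)], G.IsFnIn M

/-! ## In a model of `BASIC + Σᵇ₁-PIND` -/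

section Model

open BASICModel

variable {M : Type} [Language.boundedArith.Structure M] [hB : M ⊨ BASIC]
  [hP : M ⊨ PINDScheme (sigmabFormulas 1)]
variable {G : GDef n}

/-- A good definition defines a function in every model of `BASIC + Σᵇ₁-PIND`. [cite: Buss1986, §2.2] -/
theorem Good.isFnIn (hG : G.Good) : G.IsFnIn M := hG.isFn M

omit hB hP in
/-- The bounding term as a term function. [folklore] -/
theorem isTermFn_bound (G : GDef n) : IsTermFn fun x : Fin n → M => G.bound.realize x :=
  ⟨G.bound.relabel Sum.inr, fun x => by rw [Term.realize_relabel]; rfl⟩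

omit hB hP in
/-- The graph of a good definition is a `Σᵇ₁`-definable `(n+1)`-ary predicate (no parameters).
[cite: Buss1986, §2.2] -/
theorem Good.isSigmabDef_rel (hG : G.Good) :
    IsSigmabDef 1 fun v : Fin (n + 1) → M => G.graph.Realize v :=
  (SForm.isSigmabDef hG.sig (Sum.inr : Fin (n + 1) → M ⊕ Fin (n + 1))).of_iff fun _ => Iff.rfl

/-- **In a model of `BASIC + Σᵇ₁-PIND` the function of a good definition is a `Σᵇ₁`-definable
function** (with parameters), so that `Σᵇ₁-PIND`/`LIND` apply to predicates mentioning it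
(Buss 1986, §2.2, Thm. 2.2). [cite: Buss1986, §2.2, Thm. 2.2] -/
theorem Good.isSigmabFn (hG : G.Good) : IsSigmabFn 1 (G.fn : (Fin n → M) → M) :=
  IsSigmabFn.of_unique (R := fun v => G.graph.Realize v) hG.isSigmabDef_rel
    (fun x => hG.isFnIn.rel_fn x) (fun _ _ hy => hG.isFnIn.rel_iff.1 hy)
    ⟨_, G.isTermFn_bound, fun x => hG.isFnIn.fn_le x⟩

/-- `fn x̄ ≤ t(x̄)` in `≤`-notation. [folklore] -/
theorem Good.fn_le (hG : G.Good) (x : Fin n → M) : G.fn x ≤ G.bound.realize x := hG.isFnIn.fn_le x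

/-- `φ(x̄, y) ↔ y = fn x̄`. [folklore] -/
theorem Good.rel_iff (hG : G.Good) {x : Fin n → M} {y : M} : G.Rel x y ↔ y = G.fn x :=
  hG.isFnIn.rel_iff

end Model

/-! ## Functions given by terms -/

/-- The function given by a term `t(x̄)`: graph `y = t(x̄)`, bound `t` (Buss 1986, §2.2).
[cite: Buss1986, §2.2] -/
def ofTerm (t : Language.boundedArith.Term (Fin n)) : GDef n :=
  ⟨SForm.eq (Term.var (Fin.last n)) (t.relabel Fin.castSucc), t⟩

/-- The numeral `k` as a (constant) definition. [cite: Buss1986, §2.2] -/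
def num (n k : ℕ) : GDef n := ofTerm (natConst k)

section OfTerm

open BASICModel

variable {M : Type} [Language.boundedArith.Structure M]

/-- Semantics of `ofTerm`. [folklore] -/
theorem rel_ofTerm {t : Language.boundedArith.Term (Fin n)} {x : Fin n → M} {y : M} :
    (ofTerm t).Rel x y ↔ y = t.realize x := by
  simp [ofTerm, Rel, Term.realize_relabel, Fin.snoc_comp_castSucc]

/-- **Terms are good definitions** (in any model of `BASIC`, `≤` being reflexive).
[cite: Buss1986, §2.2] -/
theorem good_ofTerm (t : Language.boundedArith.Term (Fin n)) : (ofTerm t).Good where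
  sig := rfl
  isFn M _ _ _ :=
    { total := fun x => ⟨_, rel_ofTerm.2 rfl⟩
      unique := fun x y y' hy hy' => (rel_ofTerm.1 hy).trans (rel_ofTerm.1 hy').symm
      le_bound := fun x y hy => by
        rw [rel_ofTerm.1 hy]
        exact (mLe_iff _ _).2 le_rfl }

variable [hB : M ⊨ BASIC] [hP : M ⊨ PINDScheme (sigmabFormulas 1)]

/-- The value of `ofTerm t` is `t(x̄)`. [folklore] -/
@[simp] theorem fn_ofTerm (t : Language.boundedArith.Term (Fin n)) (x : Fin n → M) :
    (ofTerm t).fn x = t.realize x :=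
  (good_ofTerm t).isFnIn.fn_eq_of_rel (rel_ofTerm.2 rfl)

omit hP in
/-- Numerals denote the casts of natural numbers: `natConst k` realizes to `(k : M)`. [folklore] -/
theorem realize_natConst_cast {β : Type} (v : β → M) (k : ℕ) :
    (natConst k : Language.boundedArith.Term β).realize v = (k : M) := by
  induction k with
  | zero => simp [natConst]
  | succ k ih => rw [natConst, realize_term_succ, ih, mSucc_eq, Nat.cast_succ]

/-- The numeral definition is good. [cite: Buss1986, §2.2] -/
theorem good_num (n k : ℕ) : (num n k).Good := good_ofTerm _

/-- The value of the numeral definition is `(k : M)`. [folklore] -/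
@[simp] theorem fn_num (k : ℕ) (x : Fin n → M) : (num n k).fn x = (k : M) := by
  rw [num, fn_ofTerm, realize_natConst_cast]

end OfTerm

/-! ## Substituting terms for the arguments -/

/-- **Substituting terms for the arguments** of a definition: `x̄ ↦ G(σ₁(x̄), …, σₘ(x̄))`
(Buss 1986, §2.2, Thm. 2.2: the class of `Σᵇ₁`-definable functions is closed under substitution of
terms; this covers renaming, identification and permutation of arguments and dummy arguments).
[cite: Buss1986, §2.2, Thm. 2.2] -/
def substArgs (σ : Fin m → Language.boundedArith.Term (Fin n)) (G : GDef m) : GDef n :=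
  ⟨G.graph.subst (SForm.liftSubst σ), G.bound.subst σ⟩

section SubstArgs

open BASICModel

variable {M : Type} [Language.boundedArith.Structure M]
variable {σ : Fin m → Language.boundedArith.Term (Fin n)} {G : GDef m}

/-- Semantics of `substArgs`. [folklore] -/
theorem rel_substArgs {x : Fin n → M} {y : M} :
    (substArgs σ G).Rel x y ↔ G.Rel (fun j => (σ j).realize x) y := by
  simp only [Rel, substArgs, SForm.realize_subst, SForm.realize_liftSubst]

omit [Language.boundedArith.Structure M] in
/-- `substArgs` preserves goodness. [cite: Buss1986, §2.2, Thm. 2.2] -/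
theorem Good.substArgs (hG : G.Good) (σ : Fin m → Language.boundedArith.Term (Fin n)) :
    (substArgs σ G).Good where
  sig := by have := hG.sig; simp_all [SForm.IsSig, GDef.substArgs]
  isFn M _ _ _ :=
    { total := fun x => ⟨_, rel_substArgs.2 ((hG.isFn M).rel_fn _)⟩
      unique := fun x y y' hy hy' =>
        (hG.isFn M).unique _ _ _ (rel_substArgs.1 hy) (rel_substArgs.1 hy')
      le_bound := fun x y hy => by
        have := (hG.isFn M).le_bound _ _ (rel_substArgs.1 hy)
        simpa [GDef.substArgs, Term.realize_subst] using this }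

variable [hB : M ⊨ BASIC] [hP : M ⊨ PINDScheme (sigmabFormulas 1)]

/-- The value of `substArgs σ G` is `G` at the values of the terms. [folklore] -/
theorem fn_substArgs (hG : G.Good) (x : Fin n → M) :
    (substArgs σ G).fn x = G.fn fun j => (σ j).realize x :=
  (hG.substArgs σ).isFnIn.fn_eq_of_rel (rel_substArgs.2 (hG.isFnIn.rel_fn _))

end SubstArgs

/-! ## Substituting a defined function for the last argument -/

/-- Weakening of the variables `(x̄, z)` into the context `(x̄, y, z)`. [folklore] -/
def wkMid (n : ℕ) : Fin (n + 1) → Fin (n + 2) :=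
  Fin.lastCases (Fin.last (n + 1)) fun j => j.castSucc.castSucc

/-- **Substituting a definition `G(x̄)` for the last argument of a definition `F(x̄, z)`**:
graph `∃ z ≤ t_G(x̄) (φ_G(x̄, z) ∧ φ_F(x̄, z, y))`, bound `t_F(x̄, t_G(x̄))` (Buss 1986, §2.2,
Thm. 2.2 / §2.3: composition of `Σᵇ₁`-definable functions). [cite: Buss1986, §2.2, Thm. 2.2] -/
def substLast (F : GDef (n + 1)) (G : GDef n) : GDef n where
  graph := SForm.bex (G.bound.relabel Fin.castSucc)
    (SForm.and (G.graph.rel (wkMid n)) (F.graph.rel (swapLastTwo n)))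
  bound := F.bound.subst (Fin.lastCases G.bound fun j => Term.var j)

section SubstLast

open BASICModel

variable {M : Type} [Language.boundedArith.Structure M]
variable {F : GDef (n + 1)} {G : GDef n}

omit [Language.boundedArith.Structure M] in
/-- `(x̄, y, z) ∘ wkMid = (x̄, z)`. [folklore] -/
theorem snoc_snoc_comp_wkMid (x : Fin n → M) (y z : M) :
    (Fin.snoc (Fin.snoc x y) z : Fin (n + 2) → M) ∘ wkMid n = Fin.snoc x z := by
  funext j
  cases j using Fin.lastCases with
  | last => simp [wkMid]
  | cast j => simp [wkMid]

omit [Language.boundedArith.Structure M] in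
/-- `(x̄, y, z) ∘ swapLastTwo = (x̄, z, y)`. [folklore] -/
theorem snoc_snoc_comp_swapLastTwo (x : Fin n → M) (y z : M) :
    (Fin.snoc (Fin.snoc x y) z : Fin (n + 2) → M) ∘ swapLastTwo n = Fin.snoc (Fin.snoc x z) y := by
  rw [comp_swapLastTwo]
  simp

omit [Language.boundedArith.Structure M] in
/-- The values of the substitution `z ↦ t_G(x̄)`. [folklore] -/
theorem realize_lastCases_bound (x : Fin n → M) [Language.boundedArith.Structure M] :
    (fun j => (Fin.lastCases G.bound (fun j => Term.var j) j : Language.boundedArith.Term (Fin n)).realize x) =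
      Fin.snoc x (G.bound.realize x) := by
  funext j
  cases j using Fin.lastCases with
  | last => simp
  | cast j => simp

/-- Semantics of `substLast`: `∃ z ≤ t_G(x̄) (φ_G(x̄, z) ∧ φ_F(x̄, z, y))`. [folklore] -/
theorem rel_substLast {x : Fin n → M} {y : M} :
    (substLast F G).Rel x y ↔
      ∃ z, MLe z (G.bound.realize x) ∧ (G.Rel x z ∧ F.Rel (Fin.snoc x z) y) := by
  simp only [Rel, substLast, SForm.realize_bex, SForm.realize_and, SForm.realize_rel,
    Term.realize_relabel, Fin.snoc_comp_castSucc, snoc_snoc_comp_wkMid, snoc_snoc_comp_swapLastTwo]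

omit [Language.boundedArith.Structure M] in
/-- **`substLast` preserves goodness** (the bound uses monotonicity of terms,
`BASICModel.realize_term_monotone'`). [cite: Buss1986, §2.2, Thm. 2.2] -/
theorem Good.substLast (hF : F.Good) (hG : G.Good) : (substLast F G).Good where
  sig := by
    have h1 := hF.sig
    have h2 := hG.sig
    simp_all [SForm.IsSig, GDef.substLast, SForm.cls]
  isFn M _ _ _ :=
    { total := fun x => ⟨F.fn (Fin.snoc x (G.fn x)), rel_substLast.2
        ⟨G.fn x, (hG.isFn M).fn_le x, (hG.isFn M).rel_fn x, (hF.isFn M).rel_fn _⟩⟩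
      unique := fun x y y' hy hy' => by
        obtain ⟨z, -, hz, hzy⟩ := rel_substLast.1 hy
        obtain ⟨z', -, hz', hzy'⟩ := rel_substLast.1 hy'
        obtain rfl : z = z' := (hG.isFn M).unique _ _ _ hz hz'
        exact (hF.isFn M).unique _ _ _ hzy hzy'
      le_bound := fun x y hy => by
        obtain ⟨z, hzb, -, hzy⟩ := rel_substLast.1 hy
        have h1 := (hF.isFn M).le_bound _ _ hzy
        rw [mLe_iff] at h1 hzb ⊢
        refine h1.trans ?_
        simp only [GDef.substLast, Term.realize_subst, realize_lastCases_bound]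
        refine realize_term_monotone' F.bound fun j => ?_
        cases j using Fin.lastCases with
        | last => simpa using hzb
        | cast j => simp }

variable [hB : M ⊨ BASIC] [hP : M ⊨ PINDScheme (sigmabFormulas 1)]

/-- **The value of `substLast F G` is `F(x̄, G(x̄))`.** [cite: Buss1986, §2.2, Thm. 2.2] -/
theorem fn_substLast (hF : F.Good) (hG : G.Good) (x : Fin n → M) :
    (substLast F G).fn x = F.fn (Fin.snoc x (G.fn x)) :=
  (hF.substLast hG).isFnIn.fn_eq_of_rel (rel_substLast.2
    ⟨G.fn x, hG.isFnIn.fn_le x, hG.isFnIn.rel_fn x, hF.isFnIn.rel_fn _⟩)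

end SubstLast

/-! ## The primitives of the bootstrapping as good definitions -/

section Primitives

open BASICModel SForm

/-- `Pow(y)` on the variables `(S, k, y)` of `pwG`: `∃ x ≤ y (x + 1 = y ∧ |x| + 1 = |y|)`
(Krajíček 1995, p. 75). [cite: Krajicek1995, §5.4 (p. 75)] -/
def isPowSF : SForm 3 :=
  bex (Term.var 2) (and (eq (Term.succ (Term.var 3)) (Term.var 2))
    (eq (Term.succ (Term.len (Term.var 3))) (Term.len (Term.var 2))))

/-- **`pwG`**: the definition of `pw S k = 2^{min(k,|S|)}` — graph
`Pow(y) ∧ ((k ≤ |S| ∧ |y| = k + 1) ∨ (|S| < k ∧ |y| = |S| + 1))`, bound `1 # S`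
(`BASICModel.eq_pw_iff'`). [cite: Buss1986, §2.4] -/
def pwG : GDef 2 where
  graph := and isPowSF
    (or (and (le (Term.var 1) (Term.len (Term.var 0)))
          (eq (Term.len (Term.var 2)) (Term.succ (Term.var 1))))
        (and (lt (Term.len (Term.var 0)) (Term.var 1))
          (eq (Term.len (Term.var 2)) (Term.succ (Term.len (Term.var 0))))))
  bound := Term.smash (natConst 1) (Term.var 0)

variable {M : Type} [Language.boundedArith.Structure M] [hB : M ⊨ BASIC]
  [hP : M ⊨ PINDScheme (sigmabFormulas 1)]

omit hP in
/-- Semantics of `isPowSF`. [folklore] -/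
theorem realize_isPowSF (v : Fin 3 → M) : isPowSF.Realize v ↔ IsPow (v 2) := by
  simp [isPowSF, IsPow, Fin.snoc]

/-- Semantics of `pwG`: its graph is `y = pw S k`. [cite: Buss1986, §2.4] -/
theorem rel_pwG {x : Fin 2 → M} {y : M} : pwG.Rel x y ↔ y = pw (x 0) (x 1) := by
  rw [eq_pw_iff']
  simp [pwG, Rel, realize_isPowSF, Fin.snoc, SForm.lt]

/-- **`pwG` is good.** [cite: Buss1986, §2.4] -/
theorem good_pwG : pwG.Good where
  sig := rfl
  isFn M _ _ _ :=
    { total := fun x => ⟨_, rel_pwG.2 rfl⟩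
      unique := fun x y y' hy hy' => (rel_pwG.1 hy).trans (rel_pwG.1 hy').symm
      le_bound := fun x y hy => by
        rw [rel_pwG.1 hy]
        simpa [pwG] using (mLe_iff _ _).2 (pw_le (x 0) (x 1)) }

/-- The value of `pwG` is `pw`. [cite: Buss1986, §2.4] -/
@[simp] theorem fn_pwG (x : Fin 2 → M) : pwG.fn x = pw (x 0) (x 1) :=
  good_pwG.isFnIn.fn_eq_of_rel (rel_pwG.2 rfl)

/-- **`mspG`**: the definition of `msp S a k = ⌊a/2ᵏ⌋` on `(S, a, k)` — graph
`∃ v ≤ 1#S (v = pw S k ∧ ∃ r ≤ a (a = q·v + r ∧ r < v))`, bound `a` (`BASICModel.eq_msp_iff`).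
[cite: Buss1986, §2.5] -/
def mspG : GDef 3 where
  graph := bex (Term.smash (natConst 1) (Term.var 0))
    (and (pwG.graph.rel ![0, 2, 4])
      (bex (Term.var 1) (and (eq (Term.var 1) (Term.var 3 * Term.var 4 + Term.var 5))
        (lt (Term.var 5) (Term.var 4)))))
  bound := Term.var 1

/-- **`lspG`**: the definition of `lsp S a k = a mod 2ᵏ` on `(S, a, k)` — graph
`∃ v ≤ 1#S (v = pw S k ∧ ∃ q ≤ a (a = q·v + r ∧ r < v))`, bound `a` (`BASICModel.eq_lsp_iff`).
[cite: Buss1986, §2.5] -/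
def lspG : GDef 3 where
  graph := bex (Term.smash (natConst 1) (Term.var 0))
    (and (pwG.graph.rel ![0, 2, 4])
      (bex (Term.var 1) (and (eq (Term.var 1) (Term.var 5 * Term.var 4 + Term.var 3))
        (lt (Term.var 3) (Term.var 4)))))
  bound := Term.var 1

/-- `pwG`'s graph at an explicit triple. [folklore] -/
theorem realize_pwG_graph (S k v : M) : pwG.graph.Realize ![S, k, v] ↔ v = pw S k := by
  have e : (Fin.snoc ![S, k] v : Fin 3 → M) = ![S, k, v] := by
    funext j; fin_cases j <;> rfl
  have := rel_pwG (M := M) (x := ![S, k]) (y := v)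
  rw [Rel, e] at this
  simpa using this

omit [Language.boundedArith.Structure M] hB hP in
/-- Index bookkeeping for the embedded `pwG` graph. [folklore] -/
private theorem comp_024 (x : Fin 3 → M) (q v : M) :
    ((Fin.snoc (Fin.snoc x q) v : Fin 5 → M) ∘ ![(0 : Fin 5), 2, 4]) = ![x 0, x 2, v] := by
  funext j; fin_cases j <;> simp

/-- Semantics of `mspG`: its graph is `q = msp S a k`. [cite: Buss1986, §2.5] -/
theorem rel_mspG {x : Fin 3 → M} {q : M} : mspG.Rel x q ↔ q = msp (x 0) (x 1) (x 2) := by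
  rw [eq_msp_iff]
  simp only [mspG, Rel, realize_bex, realize_and, realize_rel, comp_024, realize_pwG_graph]
  constructor
  · rintro ⟨v, -, rfl, r, hr, h1, h2⟩
    refine ⟨r, by simpa using hr, by simpa using h1, ?_⟩
    simpa [SForm.lt] using h2
  · rintro ⟨r, hr, h1, h2⟩
    refine ⟨pw (x 0) (x 2), by simpa using pw_le (x 0) (x 2), rfl, r, by simpa using hr,
      by simpa using h1, ?_⟩
    simpa [SForm.lt] using h2

/-- Semantics of `lspG`: its graph is `r = lsp S a k`. [cite: Buss1986, §2.5] -/
theorem rel_lspG {x : Fin 3 → M} {r : M} : lspG.Rel x r ↔ r = lsp (x 0) (x 1) (x 2) := by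
  rw [eq_lsp_iff]
  simp only [lspG, Rel, realize_bex, realize_and, realize_rel, comp_024, realize_pwG_graph]
  constructor
  · rintro ⟨v, -, rfl, q, hq, h1, h2⟩
    refine ⟨q, by simpa using hq, by simpa using h1, ?_⟩
    simpa [SForm.lt] using h2
  · rintro ⟨q, hq, h1, h2⟩
    refine ⟨pw (x 0) (x 2), by simpa using pw_le (x 0) (x 2), rfl, q, by simpa using hq,
      by simpa using h1, ?_⟩
    simpa [SForm.lt] using h2

/-- **`mspG` is good.** [cite: Buss1986, §2.5] -/
theorem good_mspG : mspG.Good where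
  sig := rfl
  isFn M _ _ _ :=
    { total := fun x => ⟨_, rel_mspG.2 rfl⟩
      unique := fun x y y' hy hy' => (rel_mspG.1 hy).trans (rel_mspG.1 hy').symm
      le_bound := fun x y hy => by
        rw [rel_mspG.1 hy]
        simpa [mspG] using (mLe_iff _ _).2 (msp_le (x 0) (x 1) (x 2)) }

/-- **`lspG` is good.** [cite: Buss1986, §2.5] -/
theorem good_lspG : lspG.Good where
  sig := rfl
  isFn M _ _ _ :=
    { total := fun x => ⟨_, rel_lspG.2 rfl⟩
      unique := fun x y y' hy hy' => (rel_lspG.1 hy).trans (rel_lspG.1 hy').symm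
      le_bound := fun x y hy => by
        rw [rel_lspG.1 hy]
        simpa [lspG] using (mLe_iff _ _).2 (lsp_le (x 0) (x 1) (x 2)) }

/-- The value of `mspG` is `msp`. [cite: Buss1986, §2.5] -/
@[simp] theorem fn_mspG (x : Fin 3 → M) : mspG.fn x = msp (x 0) (x 1) (x 2) :=
  good_mspG.isFnIn.fn_eq_of_rel (rel_mspG.2 rfl)

/-- The value of `lspG` is `lsp`. [cite: Buss1986, §2.5] -/
@[simp] theorem fn_lspG (x : Fin 3 → M) : lspG.fn x = lsp (x 0) (x 1) (x 2) :=
  good_lspG.isFnIn.fn_eq_of_rel (rel_lspG.2 rfl)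

/-- **`blkG`**: the definition of `blk S w i B = lsp S (msp S w (i·B)) B` on `(S, w, i, B)`, by
substitution and composition from `lspG`, `mspG`. [cite: Buss1986, §2.5] -/
def blkG : GDef 4 :=
  substLast (substArgs ![Term.var 0, Term.var 4, Term.var 3] lspG)
    (substArgs ![Term.var 0, Term.var 1, Term.var 2 * Term.var 3] mspG)

omit hB hP in
/-- **`blkG` is good.** [cite: Buss1986, §2.5] -/
theorem good_blkG : blkG.Good :=
  (good_lspG.substArgs _).substLast (good_mspG.substArgs _)

/-- The value of `blkG` is `blk`. [cite: Buss1986, §2.5] -/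
@[simp] theorem fn_blkG (x : Fin 4 → M) : blkG.fn x = blk (x 0) (x 1) (x 2) (x 3) := by
  rw [blkG, fn_substLast (good_lspG.substArgs _) (good_mspG.substArgs _),
    fn_substArgs good_lspG, fn_substArgs good_mspG, fn_lspG, fn_mspG, blk]
  simp

end Primitives

/-! ## Applying terms to defined functions; sums -/

/-- **A unary term applied to a definition**: `x̄ ↦ t(F(x̄))` (Buss 1986, §2.2, Thm. 2.2).
[cite: Buss1986, §2.2, Thm. 2.2] -/
def map₁G (t : Language.boundedArith.Term (Fin 1)) (F : GDef n) : GDef n :=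
  substLast (ofTerm (t.relabel (Fin.natAdd n))) F

/-- **A binary term applied to two definitions**: `x̄ ↦ t(F(x̄), G(x̄))` (e.g. `F + G`, `F · G`)
(Buss 1986, §2.2, Thm. 2.2). [cite: Buss1986, §2.2, Thm. 2.2] -/
def map₂G (t : Language.boundedArith.Term (Fin 2)) (F G : GDef n) : GDef n :=
  substLast (substLast (ofTerm (t.relabel (Fin.natAdd n)))
    (substArgs (fun j => Term.var j.castSucc) G)) F

/-- `F + G`. [cite: Buss1986, §2.2, Thm. 2.2] -/
def addG (F G : GDef n) : GDef n := map₂G (Term.var 0 + Term.var 1) F G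

/-- `F · G`. [cite: Buss1986, §2.2, Thm. 2.2] -/
def mulG (F G : GDef n) : GDef n := map₂G (Term.var 0 * Term.var 1) F G

/-- `Σ` of a list of definitions. [cite: Buss1986, §2.2, Thm. 2.2] -/
def sumG : List (GDef n) → GDef n
  | [] => num n 0
  | F :: l => addG F (sumG l)

section Maps

open BASICModel

variable {M : Type} [Language.boundedArith.Structure M] [hB : M ⊨ BASIC]
  [hP : M ⊨ PINDScheme (sigmabFormulas 1)]

omit [Language.boundedArith.Structure M] hB hP in
/-- `map₁G` preserves goodness. [cite: Buss1986, §2.2, Thm. 2.2] -/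
theorem Good.map₁G {F : GDef n} (hF : F.Good) (t : Language.boundedArith.Term (Fin 1)) :
    (map₁G t F).Good :=
  (good_ofTerm _).substLast hF

omit [Language.boundedArith.Structure M] hB hP in
/-- `map₂G` preserves goodness. [cite: Buss1986, §2.2, Thm. 2.2] -/
theorem Good.map₂G {F G : GDef n} (hF : F.Good) (hG : G.Good) (t : Language.boundedArith.Term (Fin 2)) :
    (map₂G t F G).Good :=
  ((good_ofTerm _).substLast (hG.substArgs _)).substLast hF

omit [Language.boundedArith.Structure M] hB hP in
/-- `Fin.natAdd n 0 = Fin.last n` in `Fin (n + 1)`. [folklore] -/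
theorem natAdd_zero_fin_one : (Fin.natAdd n (0 : Fin 1) : Fin (n + 1)) = Fin.last n := Fin.ext rfl

omit [Language.boundedArith.Structure M] hB hP in
/-- `Fin.natAdd n 0 = (Fin.last n).castSucc` in `Fin (n + 2)`. [folklore] -/
theorem natAdd_zero_fin_two : (Fin.natAdd n (0 : Fin 2) : Fin (n + 2)) = (Fin.last n).castSucc :=
  Fin.ext rfl

omit [Language.boundedArith.Structure M] hB hP in
/-- `Fin.natAdd n 1 = Fin.last (n + 1)` in `Fin (n + 2)`. [folklore] -/
theorem natAdd_one_fin_two : (Fin.natAdd n (1 : Fin 2) : Fin (n + 2)) = Fin.last (n + 1) :=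
  Fin.ext rfl

/-- **The value of `map₁G`**: `t(F(x̄))`. [cite: Buss1986, §2.2, Thm. 2.2] -/
theorem fn_map₁G {F : GDef n} (hF : F.Good) (t : Language.boundedArith.Term (Fin 1)) (x : Fin n → M) :
    (map₁G t F).fn x = t.realize ![F.fn x] := by
  rw [map₁G, fn_substLast (good_ofTerm _) hF, fn_ofTerm, Term.realize_relabel]
  congr 1
  funext i
  fin_cases i
  simp [natAdd_zero_fin_one]

/-- **The value of `map₂G`**: `t(F(x̄), G(x̄))`. [cite: Buss1986, §2.2, Thm. 2.2] -/
theorem fn_map₂G {F G : GDef n} (hF : F.Good) (hG : G.Good) (t : Language.boundedArith.Term (Fin 2))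
    (x : Fin n → M) : (map₂G t F G).fn x = t.realize ![F.fn x, G.fn x] := by
  rw [map₂G, fn_substLast ((good_ofTerm _).substLast (hG.substArgs _)) hF,
    fn_substLast (good_ofTerm _) (hG.substArgs _), fn_ofTerm, fn_substArgs hG, Term.realize_relabel]
  congr 1
  funext i
  fin_cases i
  · simp [natAdd_zero_fin_two]
  · simp [natAdd_one_fin_two]

omit [Language.boundedArith.Structure M] hB hP in
/-- `addG` preserves goodness. [folklore] -/
theorem Good.addG {F G : GDef n} (hF : F.Good) (hG : G.Good) : (addG F G).Good := hF.map₂G hG _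

omit [Language.boundedArith.Structure M] hB hP in
/-- `mulG` preserves goodness. [folklore] -/
theorem Good.mulG {F G : GDef n} (hF : F.Good) (hG : G.Good) : (mulG F G).Good := hF.map₂G hG _

/-- The value of `addG`. [folklore] -/
@[simp] theorem fn_addG {F G : GDef n} (hF : F.Good) (hG : G.Good) (x : Fin n → M) :
    (addG F G).fn x = F.fn x + G.fn x := by
  rw [addG, fn_map₂G hF hG]; simp

/-- The value of `mulG`. [folklore] -/
@[simp] theorem fn_mulG {F G : GDef n} (hF : F.Good) (hG : G.Good) (x : Fin n → M) :
    (mulG F G).fn x = F.fn x * G.fn x := by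
  rw [mulG, fn_map₂G hF hG]; simp

omit [Language.boundedArith.Structure M] hB hP in
/-- `sumG` of good definitions is good. [folklore] -/
theorem good_sumG {l : List (GDef n)} (hl : ∀ F ∈ l, F.Good) : (sumG l).Good := by
  induction l with
  | nil => exact good_num _ _
  | cons F l ih =>
    exact (hl F (by simp)).addG (ih fun G hG => hl G (by simp [hG]))

/-- **The value of `sumG`** is the sum of the values. [folklore] -/
theorem fn_sumG {l : List (GDef n)} (hl : ∀ F ∈ l, F.Good) (x : Fin n → M) :
    (sumG l).fn x = (l.map fun F => F.fn x).sum := by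
  induction l with
  | nil => simp [sumG, fn_num]
  | cons F l ih =>
    rw [sumG, fn_addG (hl F (by simp)) (good_sumG fun G hG => hl G (by simp [hG])),
      ih fun G hG => hl G (by simp [hG])]
    simp

end Maps

/-! ## Definition by cases on the value of a key -/

/-- The disjunct "`v = c ∧ φ_F(x̄, y)`" of `select`, on the context `(x̄, y, v)`. [folklore] -/
def selectCase (p : ℕ × GDef n) : SForm (n + 2) :=
  SForm.and (SForm.eq (Term.var (Fin.last (n + 1))) (natConst p.1)) (p.2.graph.rel Fin.castSucc)

/-- The sum of the bounding terms of the cases and of the default. [folklore] -/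
def selectBound (cases : List (ℕ × GDef n)) (D : GDef n) : Language.boundedArith.Term (Fin n) :=
  cases.foldr (fun p t => p.2.bound + t) D.bound

/-- **Definition by cases on the value of a key definition**: if `K(x̄) = c` for an entry `(c, F)` of
`cases` then `F(x̄)`, otherwise the default `D(x̄)` — graph
`∃ v ≤ t_K (φ_K(x̄, v) ∧ (⋁ (v = c̄ ∧ φ_F(x̄, y)) ∨ (⋀ v ≠ c̄ ∧ φ_D(x̄, y))))`, bound the sum of the
bounds (Buss 1986, §2.2–2.3: definition by cases of `Σᵇ₁`-definable functions; Krajíček 1995, §5.3,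
`PV` is closed under definition by cases). [cite: Buss1986, §2.3] -/
def select (K : GDef n) (cases : List (ℕ × GDef n)) (D : GDef n) : GDef n where
  graph := SForm.bex (K.bound.relabel Fin.castSucc)
    (SForm.and (K.graph.rel (wkMid n))
      (SForm.or (SForm.disj (cases.map selectCase))
        (SForm.and (SForm.conj (cases.map fun p => SForm.ne (Term.var (Fin.last (n + 1))) (natConst p.1)))
          (D.graph.rel Fin.castSucc))))
  bound := selectBound cases D

section Select

open BASICModel

variable {M : Type} [Language.boundedArith.Structure M] [hB : M ⊨ BASIC]
  [hP : M ⊨ PINDScheme (sigmabFormulas 1)]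
variable {K D : GDef n} {cases : List (ℕ × GDef n)}

omit hB hP in
/-- Semantics of `select`. [folklore] -/
theorem rel_select {x : Fin n → M} {y : M} :
    (select K cases D).Rel x y ↔
      ∃ v, MLe v (K.bound.realize x) ∧ (K.Rel x v ∧
        ((∃ p ∈ cases, v = (natConst p.1 : Language.boundedArith.Term (Fin (n + 2))).realize
            (Fin.snoc (Fin.snoc x y) v) ∧ p.2.Rel x y) ∨
          ((∀ p ∈ cases, v ≠ (natConst p.1 : Language.boundedArith.Term (Fin (n + 2))).realize
            (Fin.snoc (Fin.snoc x y) v)) ∧ D.Rel x y))) := by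
  simp only [Rel, select, SForm.realize_bex, SForm.realize_and, SForm.realize_or, SForm.realize_rel,
    SForm.realize_disj, SForm.realize_conj, List.mem_map, Term.realize_relabel,
    Fin.snoc_comp_castSucc, snoc_snoc_comp_wkMid]
  refine exists_congr fun v => and_congr_right fun _ => and_congr_right fun _ => or_congr ?_ ?_
  · constructor
    · rintro ⟨_, ⟨p, hp, rfl⟩, h⟩
      simp only [selectCase, SForm.realize_and, SForm.realize_eq, Term.realize_var, Fin.snoc_last,
        SForm.realize_rel, Fin.snoc_comp_castSucc] at h
      exact ⟨p, hp, h.1, h.2⟩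
    · rintro ⟨p, hp, h1, h2⟩
      refine ⟨_, ⟨p, hp, rfl⟩, ?_⟩
      simp only [selectCase, SForm.realize_and, SForm.realize_eq, Term.realize_var, Fin.snoc_last,
        SForm.realize_rel, Fin.snoc_comp_castSucc]
      exact ⟨h1, h2⟩
  · refine and_congr ⟨fun h p hp => ?_, fun h φ ⟨p, hp, hφ⟩ => ?_⟩ Iff.rfl
    · have := h _ ⟨p, hp, rfl⟩
      simpa only [SForm.realize_ne, Term.realize_var, Fin.snoc_last] using this
    · subst hφ
      simpa only [SForm.realize_ne, Term.realize_var, Fin.snoc_last] using h p hp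

omit hP in
/-- The value of the bounding term of `select`. [folklore] -/
theorem realize_selectBound (x : Fin n → M) :
    (selectBound cases D).realize x = (cases.map fun p => p.2.bound.realize x).sum + D.bound.realize x := by
  induction cases with
  | nil => simp [selectBound]
  | cons p l ih =>
    simp only [selectBound, List.foldr_cons, List.map_cons, List.sum_cons] at ih ⊢
    rw [realize_term_add, mAdd_eq, ih, add_assoc]

omit hP in
/-- Each case bound is below the bound of `select`. [folklore] -/
theorem bound_le_selectBound (x : Fin n → M) {p : ℕ × GDef n} (hp : p ∈ cases) :
    p.2.bound.realize x ≤ (selectBound cases D).realize x := by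
  rw [realize_selectBound]
  refine le_trans ?_ (le_add_right'' _ _)
  induction cases with
  | nil => simp at hp
  | cons q l ih =>
    simp only [List.map_cons, List.sum_cons]
    rcases List.mem_cons.1 hp with rfl | hp
    · exact le_add_right'' _ _
    · exact (ih hp).trans (le_add_left'' _ _)

omit hP in
/-- The default bound is below the bound of `select`. [folklore] -/
theorem bound_le_selectBound_default (x : Fin n → M) :
    D.bound.realize x ≤ (selectBound cases D).realize x := by
  rw [realize_selectBound]; exact le_add_left'' _ _

omit [Language.boundedArith.Structure M] hB hP in
/-- The graph of `select` is `Σᵇ₁` when all components are. [folklore] -/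
theorem isSig_select (hK : K.graph.IsSig) (hc : ∀ p ∈ cases, p.2.graph.IsSig) (hD : D.graph.IsSig) :
    (select K cases D).graph.IsSig := by
  have h1 : (SForm.disj (cases.map selectCase)).IsSig := by
    refine SForm.isSig_disj fun φ hφ => ?_
    obtain ⟨p, hp, rfl⟩ := List.mem_map.1 hφ
    have := hc p hp
    simp_all [SForm.IsSig, selectCase, SForm.cls]
  have h2 : (SForm.conj (cases.map fun p => SForm.ne (Term.var (Fin.last (n + 1)))
      (natConst p.1 : Language.boundedArith.Term (Fin (n + 2))))).IsSB := by
    refine SForm.isSB_conj fun φ hφ => ?_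
    obtain ⟨p, -, rfl⟩ := List.mem_map.1 hφ
    simp [SForm.IsSB]
  have h3 := h2.isSig
  simp_all [SForm.IsSig, SForm.IsSB, select, SForm.cls]

/-- **`select` is good** when the key, the cases and the default are good and the case labels are
distinct (numerals are distinct in a model of `BASIC`, which has characteristic zero).
[cite: Buss1986, §2.3] -/
theorem good_select (hK : K.Good) (hc : ∀ p ∈ cases, p.2.Good) (hD : D.Good)
    (hnd : (cases.map Prod.fst).Nodup) : (select K cases D).Good where
  sig := isSig_select hK.sig (fun p hp => (hc p hp).sig) hD.sig
  isFn M _ _ _ := by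
    have hcast : ∀ (p : ℕ × GDef n) (x : Fin n → M) (y v : M),
        (natConst p.1 : Language.boundedArith.Term (Fin (n + 2))).realize (Fin.snoc (Fin.snoc x y) v) =
          (p.1 : M) := fun p x y v => realize_natConst_cast _ _
    refine ⟨fun x => ?_, fun x y y' hy hy' => ?_, fun x y hy => ?_⟩
    · -- existence
      by_cases h : ∃ p ∈ cases, K.fn x = (p.1 : M)
      · obtain ⟨p, hp, hpK⟩ := h
        refine ⟨p.2.fn x, rel_select.2 ⟨K.fn x, (hK.isFn M).fn_le x, (hK.isFn M).rel_fn x, Or.inl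
          ⟨p, hp, by rw [hcast, hpK], ((hc p hp).isFn M).rel_fn x⟩⟩⟩
      · push Not at h
        refine ⟨D.fn x, rel_select.2 ⟨K.fn x, (hK.isFn M).fn_le x, (hK.isFn M).rel_fn x, Or.inr
          ⟨fun p hp => by rw [hcast]; exact h p hp, (hD.isFn M).rel_fn x⟩⟩⟩
    · -- uniqueness
      obtain ⟨v, -, hv, h⟩ := rel_select.1 hy
      obtain ⟨v', -, hv', h'⟩ := rel_select.1 hy'
      obtain rfl : v = v' := (hK.isFn M).unique _ _ _ hv hv'
      simp only [hcast] at h h'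
      rcases h with ⟨p, hp, hpv, hpy⟩ | ⟨hne, hDy⟩ <;> rcases h' with ⟨p', hp', hpv', hpy'⟩ | ⟨hne', hDy'⟩
      · have hpp : p.1 = p'.1 := by exact_mod_cast hpv.symm.trans hpv'
        obtain rfl : p = p' := by
          obtain ⟨i, hi, rfl⟩ := List.getElem_of_mem hp
          obtain ⟨i', hi', rfl⟩ := List.getElem_of_mem hp'
          have := (List.nodup_iff_injective_getElem.1 hnd) (a₁ := ⟨i, by simpa using hi⟩)
            (a₂ := ⟨i', by simpa using hi'⟩) (by simpa using hpp)
          simp only [Fin.mk.injEq] at this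
          subst this
          rfl
        exact ((hc p hp).isFn M).unique _ _ _ hpy hpy'
      · exact absurd hpv (hne' p hp)
      · exact absurd hpv' (hne p' hp')
      · exact (hD.isFn M).unique _ _ _ hDy hDy'
    · -- bound
      obtain ⟨v, -, -, h⟩ := rel_select.1 hy
      rw [mLe_iff]
      rcases h with ⟨p, hp, -, hpy⟩ | ⟨-, hDy⟩
      · exact ((mLe_iff _ _).1 (((hc p hp).isFn M).le_bound _ _ hpy)).trans (bound_le_selectBound x hp)
      · exact ((mLe_iff _ _).1 ((hD.isFn M).le_bound _ _ hDy)).trans (bound_le_selectBound_default x)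

/-- **The value of `select` at a listed key**: `F(x̄)` if `K(x̄) = c` and `(c, F) ∈ cases`.
[cite: Buss1986, §2.3] -/
theorem fn_select_of_mem (hK : K.Good) (hc : ∀ p ∈ cases, p.2.Good) (hD : D.Good)
    (hnd : (cases.map Prod.fst).Nodup) (x : Fin n → M) {p : ℕ × GDef n} (hp : p ∈ cases)
    (hpK : K.fn x = (p.1 : M)) : (select K cases D).fn x = p.2.fn x :=
  (good_select hK hc hD hnd).isFnIn.fn_eq_of_rel (rel_select.2
    ⟨K.fn x, hK.isFnIn.fn_le x, hK.isFnIn.rel_fn x, Or.inl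
      ⟨p, hp, by rw [realize_natConst_cast, hpK], (hc p hp).isFnIn.rel_fn x⟩⟩)

/-- **The value of `select` at an unlisted key**: the default `D(x̄)`. [cite: Buss1986, §2.3] -/
theorem fn_select_of_not_mem (hK : K.Good) (hc : ∀ p ∈ cases, p.2.Good) (hD : D.Good)
    (hnd : (cases.map Prod.fst).Nodup) (x : Fin n → M) (h : ∀ p ∈ cases, K.fn x ≠ (p.1 : M)) :
    (select K cases D).fn x = D.fn x :=
  (good_select hK hc hD hnd).isFnIn.fn_eq_of_rel (rel_select.2
    ⟨K.fn x, hK.isFnIn.fn_le x, hK.isFnIn.rel_fn x, Or.inr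
      ⟨fun p hp => by rw [realize_natConst_cast]; exact h p hp, hD.isFnIn.rel_fn x⟩⟩)

end Select

end GDef

end Literature.Computability.MetaComplexity
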